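import Mathlib
import Summits.Ventures.PercRepro2.HMFRootEdge
import Summits.Ventures.PercRepro2.HMFSwap

/-!
# (HMF) across a root edge at `a₃` is the sign of the cofactor; the `a₂` edge by root symmetry
(blind cell PercRepro2, night-1 g17; NIGHT1-G17.md §4)

* **`HMF_iff_Phi_nonneg`**: for an edge `f = {a₃, a₁}` of weight `< 1`, `(HMF) ↔ 0 ≤ Φ_f`
  (`HMFc = (1 − p f) Φ_f`, `RootEdge.HMFc_eq_factor`); at weight `1` (HMF) holds outright
  (`HMF_of_sure_edge`), and `Φ_f ≥ 0` there too (`Phi_nonneg_of_sure`);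
* **`HMFc_eq_factor'`** / **`Phi_nonneg_of_sure'`**: the same across an edge `f = {a₃, a₂}`, by the
  root symmetry `HMFSwap.HMFc_root_swap` (the cofactor is `Φ_f` of the instance with the roots
  exchanged).

Own code; standard axioms.
-/

namespace Summit.Ventures.PercRepro2

open UnionCluster CovForm

namespace RootEdge

variable {V : Type*} {E : Type*} [Fintype E] [DecidableEq E] [Fintype V] [DecidableEq V]
  {R : Type*} [Field R] [LinearOrder R] [IsStrictOrderedRing R]

variable (p : E → R) (ends : E → Sym2 V) (o a₁ a₂ a₃ b : V) {f : E}

/-- **(HMF) across a root edge of weight `< 1` is the sign of the cofactor `Φ_f`.** -/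
theorem HMF_iff_Phi_nonneg (hf : ends f = s(a₃, a₁)) (hq : p f < 1) :
    HMF p ends o a₁ a₂ a₃ b ↔ 0 ≤ Phi p ends o a₁ a₂ a₃ b f := by
  unfold HMF
  rw [HMFc_eq_factor p ends o b hf]
  have h : 0 < 1 - p f := by linarith
  exact mul_nonneg_iff_of_pos_left h

/-- **The factorisation across an edge `{a₃, a₂}`** (root symmetry): the cofactor is `Φ_f` of the
instance with the roots exchanged. -/
theorem HMFc_eq_factor' (hf : ends f = s(a₃, a₂)) :
    HMFc p ends o a₁ a₂ a₃ b = (1 - p f) * Phi p ends o a₂ a₁ a₃ b f := by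
  rw [← HMFSwap.HMFc_root_swap p ends o a₁ a₂ a₃ b]
  exact HMFc_eq_factor p ends o b hf

/-- **The first-order coefficient at the coincidence `a₃ = a₂` is nonnegative** in every graph. -/
theorem Phi_nonneg_of_sure' (hp : IsProbVec p) (hf : ends f = s(a₃, a₂)) (h1 : p f = 1) :
    0 ≤ Phi p ends o a₂ a₁ a₃ b f :=
  Phi_nonneg_of_sure p ends o a₂ a₁ a₃ b hp hf h1

/-- **(HMF) across an edge `{a₃, a₂}` of weight `< 1` is the sign of the swapped cofactor.** -/
theorem HMF_iff_Phi_nonneg' (hf : ends f = s(a₃, a₂)) (hq : p f < 1) :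
    HMF p ends o a₁ a₂ a₃ b ↔ 0 ≤ Phi p ends o a₂ a₁ a₃ b f := by
  unfold HMF
  rw [HMFc_eq_factor' p ends o a₁ a₂ a₃ b hf]
  have h : 0 < 1 - p f := by linarith
  exact mul_nonneg_iff_of_pos_left h

end RootEdge

end Summit.Ventures.PercRepro2
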